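import Summits.BirchSwinnertonDyer.BirchSwinnertonDyer.Theses.SignedLowerHalves
import Summits.BirchSwinnertonDyer.BirchSwinnertonDyer.Theorems.SignedLowerHalvesSprungLowerHalfAtThreeKDotSplitReal
import Summits.BirchSwinnertonDyer.BirchSwinnertonDyer.Theorems.SignedLowerHalvesSprungLowerHalfAtThreeSprungPairOfModularity
import Summits.BirchSwinnertonDyer.BirchSwinnertonDyer.Theorems.SprungSharpFlatMainConjecture
import Literature.NumberTheory.EllipticCurves.Sprung2012.SharpFlatKatoDivisibility
import Literature.NumberTheory.EllipticCurves.CyclotomicZpExtensionLocalGeneratorProofs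
import Literature.NumberTheory.EllipticCurves.Sprung2017.SharpFlatNonvanishingProofs
import Literature.NumberTheory.EllipticCurves.Sprung2024.ChromaticCharValueRankZeroAllN
import HarnessLib

/-!
# Route `SignedLowerHalves`, crux 5 `SprungLowerHalfAtThree` — the KDOT split's GLUE item PROVED
# (`SprungLowerHalfAtThreeGlue`, item stmt-BirchSwinnertonDyer-19880; route rev 13/14, split gen 1
# of item stmt-BirchSwinnertonDyer-19003; cell `bsd-ssimc`, seat `bsd-ssimc-k3c5-kdot-split` g4)

PARTITION (cell bsd-ssimc): X8 (A8) — `p = 3` good supersingular, `a_3 = ±3` — all conductors, crux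
5 at every analytic rank; proves-the-glue-of; closes the GLUE item only (crux 5 stays open behind its
two open children K1, K2); 0 census moves; BSD is not proved by any of this.

## What this file proves

`sprungLowerHalfAtThreeGlue_holds : SprungLowerHalfAtThreeGlue`, i.e. AS TYPED in the route file

  `SprungLowerDivisibilityAtThree → SharpFlatRankZeroConverseAtThree →
     SharpFlatCharValueRankZeroAllLevels → SharpFlatPublishedInputsAtThree → SprungLowerHalfAtThree`,

the four children being the tenure planner's split of record (bsd-ssimc-plan g24, D24-1/D24-2/D24-10,
rev 13 VARIANT B; rev 14 restated the fourth child):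

* **K1** `SprungLowerDivisibilityAtThree` (crux, stmt-BirchSwinnertonDyer-19875) — on X8, for every
  colour `•`, `Theorems.SprungSharpFlatLowerDivisibility W p •`: the Eisenstein half (MC↓•) of
  Sprung 2012 Main Conj. 7.21 on the REAL `X^•(E/ℚ_∞)` (guarded by `L^• ≠ 0`). OPEN.
* **K2** `SharpFlatRankZeroConverseAtThree` (crux, stmt-BirchSwinnertonDyer-19877) — (conv₀) on X8:
  `Finite Sel_{p^∞}(E/ℚ) → L(E,1) ≠ 0`. OPEN.
* **K3** `SharpFlatCharValueRankZeroAllLevels` (support, stmt-BirchSwinnertonDyer-19878) :=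
  `Sprung2024.lem59AllN_sharpFlatCharValue_rankZero` BY NAME ((K•) at all levels; HELD input).
* **S4** `SharpFlatPublishedInputsAtThree` (support, stmt-BirchSwinnertonDyer-19929, rev 14) — the
  published inputs RESTRICTED TO X8 and SPELLED OUT: (M) a weight-2 newform of `W`; and in Sprung's
  cyclotomic setting `(κ, γ, v ∣ 3, g)`: (H) a Honda system exists (Sprung 2012 Thm. 2.2 at `p = 3`),
  (T) for every Honda system, newform, colour with `L^• ≠ 0`, Sprung pair and dual datum `D`, `D.X`
  is finitely generated torsion over `Λ` (Sprung 2012 Thm. 1.2 = 7.14 at `p = 3`). HELD input; the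
  one-line edges `thm22 → thm714 → exists_isNewformOf → S4` live in the companion file
  `SignedLowerHalvesSprungLowerHalfAtThreeSplitInputs.lean`.

Proof (= planner Sketch-D / `K3-route/rev14/GlueLanding-E.lean`, re-checked on the farm by this
seat; the g3 kernel glue `sprungLowerHalfAtThree_of_kdotSplit` (p478990) is the same argument against
the rev-13 global spelling of S4): fix an X8 pair `(W, p)`; S4(M) gives a newform, hence the real
objects `(f, ϖ, L♯, L♭)` of clause (A) by `stub_sprungPair_of_isNewformOf` (p453712). If
`Sel_{p^∞}(E/ℚ)` is infinite the datum is `ξ = h = 0` (`chromaticDatum_of_not_finite_selmer`, colour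
♭). Otherwise `p = 3`, K2 gives `L(E,1) ≠ 0`; the cyclotomic `(κ, γ)` is
`exists_isCyclotomic_isTopGenerator_isCyclotomicVariable_holds`, the place `v ∋ 3` is
`RingOfIntegers.exists_heightOneSpectrum_natCast_mem`, the local lift `g` of `γ` is
`ZpExtension.IsCyclotomic.exists_isTopGenerator_resGalOfEmb_adicCompletion` (p473737); S4(H) gives a
Honda system `(c₋, c)`; `IsSprungPair.exists_chromaticL_ne_zero` gives a colour `•` with `L^• ≠ 0`
(Sprung 2012 Prop. 6.14); `D := Sprung2012.sharpFlatSelmerDualData …` is the real `X^•(E/ℚ_∞)`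
(p470048); K1 gives a generator `gen` of `char_Λ(D.X)` with `ι gen = ϖ · ι(L^• · h)`; S4(T) gives
`Module.Finite ∧ Module.IsTorsion` for `D.X`; K3 gives Kim's unit
`gen(0) = u · 3^{ord₃ ∏ c_ℓ} · #Sel_{3^∞}(E/ℚ)`, which is `SignedDatum.EulerCharacteristic` for
`⟨gen, 0, 0⟩`.

HONEST STATUS: this closes the GLUE item (pure logic over the tree's objects), nothing else. Crux 5
now reads, BY NAME and in the kernel, `K1 ∧ K2 ∧ K3 ∧ S4 ⟹ SprungLowerHalfAtThree` with K1 (MC↓•)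
and K2 (conv₀) OPEN cruxes and K3, S4 HELD published inputs; 0 cells of the census move; BSD is not
proved by any of this.

References: [Sprung2012] Thm. 2.2, Thm. 1.2/7.14, Prop. 6.14, Def. 7.11, Main Conj. 7.21;
[Sprung2024] §5.2 Lemmas 5.5–5.9; [RaySprung2025] p. 2343; [BCDTJAMS2001] Thm. A;
[Sprung2017] Thm. 1.12.
-/

set_option autoImplicit false
-- justification: the mandated namespace `Summit.BirchSwinnertonDyer.BirchSwinnertonDyer.Theorems`
-- (single-conjunct summit, Sub = Summit) repeats a segment by design (D-0017).
set_option linter.dupNamespace false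

noncomputable section

namespace Summit.BirchSwinnertonDyer.BirchSwinnertonDyer.Theorems.SprungLowerHalfAtThreeSplit

open scoped Classical NumberField MatrixGroups ModularForm
open NumberField IsDedekindDomain WeierstrassCurve CongruenceSubgroup
  Literature.NumberTheory.EllipticCurves Literature.NumberTheory.EllipticCurves.ModularForms
  Literature.NumberTheory.EllipticCurves.Rank1Residual
  Literature.NumberTheory.EllipticCurves.Sprung2017 Literature.NumberTheory.EllipticCurves.Sprung2012
  Literature.NumberTheory.EllipticCurves.ZpExtension
  Summit.BirchSwinnertonDyer.Rank1Residual.Supersingular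
  Summit.BirchSwinnertonDyer.BirchSwinnertonDyer.Theses.SignedLowerHalves

/-- **The KDOT split's glue, AS TYPED: `K1 → K2 → K3 → S4 → SprungLowerHalfAtThree`** (item
stmt-BirchSwinnertonDyer-19880; every X8 pair, any conductor, every analytic rank). K1 =
`SprungLowerDivisibilityAtThree` ((MC↓•) by name, OPEN), K2 = `SharpFlatRankZeroConverseAtThree`
((conv₀), OPEN), K3 = `SharpFlatCharValueRankZeroAllLevels` (= `Sprung2024.lem59AllN_…`, HELD), S4 =
`SharpFlatPublishedInputsAtThree` (X8-restricted newform existence, Honda system, `Λ`-torsion of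
`X^•`; HELD). Proof: module docstring (stub (A) from S4(M); Selmer infinite ⇒ `ξ = 0`; else K2 ⇒
`L(E,1) ≠ 0`, a colour with `L^• ≠ 0` by Prop. 6.14, the real datum `sharpFlatSelmerDualData`, its
generator from K1, cotorsion from S4(T), the unit from K3; the local lift of `γ` is PROVED, p473737).
Pure glue: CONDITIONAL on nothing beyond its four displayed hypotheses; closes the glue item only.
[cite: Sprung2012, Thm. 2.2, Thm. 1.2, Prop. 6.14 and Main Conj. 7.21]
[cite: Sprung2024, §5.2 Lemmas 5.5–5.9] [cite: BCDTJAMS2001, Thm. A] -/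
theorem sprungLowerHalfAtThreeGlue_holds :
    Summit.BirchSwinnertonDyer.BirchSwinnertonDyer.Theses.SignedLowerHalves.SprungLowerHalfAtThreeGlue := by
  unfold Summit.BirchSwinnertonDyer.BirchSwinnertonDyer.Theses.SignedLowerHalves.SprungLowerHalfAtThreeGlue
  intro hK1 hK2 hK3 hS4 W _ _ p _ hX
  -- S4(M): a newform of `W`; stub (A): the real objects `(f, ϖ, L♯, L♭)` (p453712)
  obtain ⟨⟨N₀, hN₀, f₀, hf₀⟩, hS4'⟩ := hS4 W p hX
  haveI := hN₀
  obtain ⟨N, hN, f, ϖ, Lsharp, Lflat, hf, hϖ, hSP⟩ :=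
    stub_sprungPair_of_isNewformOf W p hX f₀ hf₀
  suffices hB : ∃ (col : Chroma) (ξ : IwasawaAlgebra p),
      (⟨ξ, 0, 0⟩ : SignedDatum W p).EulerCharacteristic ∧
        ∃ h : IwasawaAlgebra p, iwasawaToPowerSeries p ξ =
          PowerSeries.C (ϖ : ℚ_[p]) * iwasawaToPowerSeries p (chromaticL col Lsharp Lflat * h) by
    obtain ⟨col, ξ, hK, hdiv⟩ := hB
    exact ⟨N, hN, f, ϖ, Lsharp, Lflat, col, ξ, hf, hϖ, hSP, hK, hdiv⟩
  -- positive corank: `ξ = h = 0`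
  by_cases hfin : Finite (W.selmerGroupPInfty p)
  swap
  · exact ⟨.flat, chromaticDatum_of_not_finite_selmer W p hfin ϖ (chromaticL .flat Lsharp Lflat)⟩
  -- corank zero: `p = 3`, (conv₀), the cyclotomic setting, the local lift (PROVED), a Honda system
  have hp3 : p = 3 := hX.1
  subst hp3
  have hp2 : (3 : ℕ) ≠ 2 := by decide
  have hgood : W.HasGoodReductionAtPrime 3 := hX.2.1.1
  have hdvd : ((3 : ℕ) : ℤ) ∣ W.frobeniusTrace 3 := hX.2.1.2
  have hL : W.entireLFunction 1 ≠ 0 := hK2 W 3 hX hfin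
  obtain ⟨κ, hκ, γ, hγ, hγ'⟩ := exists_isCyclotomic_isTopGenerator_isCyclotomicVariable_holds 3
  obtain ⟨v, hv⟩ :=
    Literature.NumberTheory.NumberFields.RingOfIntegers.exists_heightOneSpectrum_natCast_mem ℚ
      (p := 3) (by norm_num)
  obtain ⟨g, hg⟩ := hκ.exists_isTopGenerator_resGalOfEmb_adicCompletion v hv
  obtain ⟨⟨cneg, c, hc⟩, h714⟩ := hS4' κ γ hκ hγ hγ' v hv g hg
  -- a colour with `L^• ≠ 0` (Sprung 2012 Prop. 6.14, tree theorem)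
  obtain ⟨col, hcol⟩ := hSP.exists_chromaticL_ne_zero hf hgood
  -- Sprung's real `X^•(E/ℚ_∞)` (p470048)
  let D := sharpFlatSelmerDualData W κ (closureEmb (K := ℚ) (v.adicCompletion ℚ))
    (W.frobeniusTrace 3) g c col hγ
  -- (MC↓•) by name: a generator of `char_Λ(X^•)` divisible by `ϖ · L^•`
  obtain ⟨gen, h, hchar, hι⟩ :=
    hK1 W 3 hX col κ γ hκ hγ hγ' v hv g hg cneg c hc N hN f ϖ Lsharp Lflat hf hϖ hSP hcol D
  -- cotorsion at ANY level (S4(T) = Sprung 2012 Thm. 7.14) and (K•) at all levels (K3)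
  haveI := hN
  obtain ⟨hfinD, htorD⟩ := h714 cneg c hc N hN f hf col Lsharp Lflat hSP hcol D
  haveI := hfinD
  obtain ⟨u, hu⟩ :=
    hK3 W 3 hp2 hgood hdvd hL κ γ hκ hγ hγ' v hv g hg cneg c hc col D htorD gen hchar hfin
  exact ⟨col, gen, fun _ => ⟨u, hu⟩, h, hι⟩

end Summit.BirchSwinnertonDyer.BirchSwinnertonDyer.Theorems.SprungLowerHalfAtThreeSplit

end
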